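import Summits.Ventures.PercRepro.MSTheoremS

/-!
# The unique non-face lemma ((U1) of Addendum 38)

Dossier proofs/MINE1-theoremS.md, Addendum 38 §1, and proofs/MINE1-RSTARM-PROOF.md §2. Let `A` be
the faces of `L'` inside `u` (a family of subsets of `u` containing `∅` but not `u`), `C` the faces
of `C` inside `u` (`u ∉ C`), with (Sig): every `x ∈ A` with `u \ x ∉ A` lies in `C`, and the count
`|A ∩ C| = |A^⊥ ∩ C| + 1` of (F2) on the `u`-restriction (`A^⊥ = complWithin u A`, the
`u`-complements of the faces). Then **`u` is the only `x ⊆ u` with `u \ x ∈ A`, `x ∉ A`, `x ∉ C`**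
(`eq_of_sdiff_mem_of_notMem`).

Proof. Split `A` into the self-dual faces `SD` (`x, u \ x ∈ A`), `A⁻` (`x ∈ A`, `u \ x ∉ A`) and
let `A⁺` (`u \ x ∈ A`, `x ∉ A`) be their complements, `|A⁻| = |A⁺|`; (Sig) puts `A⁻ ⊆ C`, so
`|A ∩ C| = |SD ∩ C| + |A⁻|` while `|A^⊥ ∩ C| = |SD ∩ C| + |A⁺ ∩ C|`; the count gives
`|A⁺ \ C| = 1`, and `u ∈ A⁺ \ C`.

In the instance the count is (F2) for the restriction of the instance to `u` ((F5) iterated);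
the consequences (Addendum 38 (S1)–(S5)) are paper for now.
-/

namespace PercRepro.MSTight

open Finset

variable {α : Type*} [DecidableEq α]

/-- For `x ⊆ u`: `x` is a `u`-complement of a member of `A` iff `u \ x ∈ A`. -/
theorem mem_complWithin_iff_sdiff_mem {u x : Finset α} {A : Finset (Finset α)}
    (hA : ∀ y ∈ A, y ⊆ u) (hx : x ⊆ u) : x ∈ complWithin u A ↔ u \ x ∈ A := by
  rw [mem_complWithin]
  constructor
  · rintro ⟨y, hy, rfl⟩
    rwa [Finset.sdiff_sdiff_eq_self (hA y hy)]
  · intro h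
    exact ⟨u \ x, h, Finset.sdiff_sdiff_eq_self hx⟩

/-- **(U1), the unique non-face.** -/
theorem eq_of_sdiff_mem_of_notMem {u : Finset α} {A C : Finset (Finset α)}
    (hA : ∀ x ∈ A, x ⊆ u) (hempty : ∅ ∈ A) (hu : u ∉ A) (huC : u ∉ C)
    (hSig : ∀ x ∈ A, u \ x ∉ A → x ∈ C)
    (hcount : (A ∩ C).card = (complWithin u A ∩ C).card + 1)
    {x : Finset α} (hxu : x ⊆ u) (hx : u \ x ∈ A) (hxA : x ∉ A) (hxC : x ∉ C) : x = u := by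
  set Ap := complWithin u A with hAp
  -- the three parts
  set SDC := (A ∩ C).filter (fun y => u \ y ∈ A) with hSDC
  set Am := A.filter (fun y => u \ y ∉ A) with hAm
  set ApC := (Ap ∩ C).filter (fun y => y ∈ A) with hApC
  set Ap' := Ap.filter (fun y => y ∉ A) with hAp'
  -- (1) |A ∩ C| = |SDC| + |Am|, because A⁻ ⊆ C by (Sig)
  have h1 : (A ∩ C).card = SDC.card + Am.card := by
    have e : (A ∩ C).filter (fun y => ¬ (u \ y ∈ A)) = Am := by
      ext y
      simp only [hAm, mem_filter, mem_inter]
      constructor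
      · rintro ⟨⟨hyA, _⟩, hyc⟩
        exact ⟨hyA, hyc⟩
      · rintro ⟨hyA, hyc⟩
        exact ⟨⟨hyA, hSig y hyA hyc⟩, hyc⟩
    rw [← e, card_filter_add_card_filter_not]
  -- (2) |Ap ∩ C| = |ApC| + |Ap' ∩ C|
  have h2 : (Ap ∩ C).card = ApC.card + ((Ap ∩ C).filter (fun y => ¬ (y ∈ A))).card := by
    rw [card_filter_add_card_filter_not]
  -- (3) SDC = ApC as finsets
  have h3 : SDC = ApC := by
    ext y
    simp only [hSDC, hApC, mem_filter, mem_inter]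
    constructor
    · rintro ⟨⟨hyA, hyC⟩, hyc⟩
      exact ⟨⟨(mem_complWithin_iff_sdiff_mem hA (hA y hyA)).2 hyc, hyC⟩, hyA⟩
    · rintro ⟨⟨hyAp, hyC⟩, hyA⟩
      exact ⟨⟨hyA, hyC⟩, (mem_complWithin_iff_sdiff_mem hA (hA y hyA)).1 hyAp⟩
  -- (4) |Am| = |Ap'| via y ↦ u \ y
  have h4 : Am.card = Ap'.card := by
    refine card_bij (fun y _ => u \ y) ?_ ?_ ?_
    · intro y hy
      simp only [hAm, mem_filter] at hy
      simp only [hAp', mem_filter]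
      refine ⟨?_, hy.2⟩
      rw [hAp, mem_complWithin]
      exact ⟨y, hy.1, rfl⟩
    · intro y₁ hy₁ y₂ hy₂ h
      simp only [hAm, mem_filter] at hy₁ hy₂
      have e₁ := Finset.sdiff_sdiff_eq_self (hA y₁ hy₁.1)
      have e₂ := Finset.sdiff_sdiff_eq_self (hA y₂ hy₂.1)
      rw [← e₁, ← e₂, h]
    · intro z hz
      simp only [hAp', mem_filter] at hz
      obtain ⟨hzAp, hzA⟩ := hz
      rw [hAp, mem_complWithin] at hzAp
      obtain ⟨y, hyA, rfl⟩ := hzAp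
      refine ⟨y, ?_, rfl⟩
      simp only [hAm, mem_filter]
      exact ⟨hyA, hzA⟩
  -- (5) the count: |Ap' ∩ C| + 1 = |Ap'|
  have h5 : ((Ap ∩ C).filter (fun y => ¬ (y ∈ A))).card + 1 = Ap'.card := by
    have := hcount
    rw [h1, h2, h3] at this
    omega
  -- (6) Ap' = (Ap' ∩ C) ⊔ (Ap' \ C): so |Ap'.filter (∉ C)| = 1
  have h6 : (Ap'.filter (fun y => y ∈ C)).card + (Ap'.filter (fun y => ¬ (y ∈ C))).card
      = Ap'.card := card_filter_add_card_filter_not _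
  have h7 : Ap'.filter (fun y => y ∈ C) = (Ap ∩ C).filter (fun y => ¬ (y ∈ A)) := by
    ext y
    simp only [hAp', mem_filter, mem_inter]
    tauto
  have h8 : (Ap'.filter (fun y => ¬ (y ∈ C))).card = 1 := by
    rw [h7] at h6
    omega
  -- (7) `u` and `x` both lie in the singleton `Ap'.filter (∉ C)`
  have hu' : u ∈ Ap'.filter (fun y => ¬ (y ∈ C)) := by
    simp only [hAp', mem_filter]
    refine ⟨⟨?_, hu⟩, huC⟩
    rw [hAp, mem_complWithin]
    exact ⟨∅, hempty, sdiff_empty⟩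
  have hx' : x ∈ Ap'.filter (fun y => ¬ (y ∈ C)) := by
    simp only [hAp', mem_filter]
    refine ⟨⟨?_, hxA⟩, hxC⟩
    rw [hAp]
    exact (mem_complWithin_iff_sdiff_mem hA hxu).2 hx
  exact card_le_one.1 (le_of_eq h8) x hx' u hu'

end PercRepro.MSTight
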